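import Summits.CriticalPhenomena.CardyFormulaZ2.Theses.CardyComplexCone
import Summits.CriticalPhenomena.CardyFormulaZ2.Theorems.CardyComplexConeDefs
import Summits.CriticalPhenomena.CardyFormulaZ2.Theorems.CardyComplexConeEdgePrecompactIpAsymptotic
import Summits.CriticalPhenomena.CardyFormulaZ2.Theorems.CardyComplexConeEdgePrecompactHalfArmLeStrip
import Summits.CriticalPhenomena.CardyFormulaZ2.Theorems.CardyComplexConeEdgePrecompactIpExact
import Summits.CriticalPhenomena.CardyFormulaZ2.Theorems.CardyComplexConeEdgePrecompactTranslationCovariance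
import Summits.CriticalPhenomena.CardyFormulaZ2.Theorems.CardyComplexConeEdgePrecompactShiftStabilityReduction
import Literature.Probability.LatticeModels.DartPhase

/-!
# Line `qkz-strip-boundary-arm` for crux `CardyComplexCone.EdgePrecompact` (stmt-CriticalPhenomena-11387)

Skeleton (crux-plan, planner-cruxplan-stmt-CriticalPhenomena-11387-qkz-strip-boundary-a-0, 2026-08-16) of
crux idea `Cruxes/EdgePrecompact/Ideas/qkz-strip-boundary-arm.md` (crux-ideate r1, ideator 3; triage r1-1/2/3:
pass ×3), with the triage sharpenings built in: (a) the integrable calibration is CITED AND TYPED from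
Ikhlef–Ponsaing, *Finite-size left-passage probability in percolation*, J. Stat. Phys. 149 (2012) 10–36
(arXiv:1202.5476), Props. 4.5, 4.7, 4.9 — not re-conjectured from MNdGB 2004; (b) the strip is the
DIAGONAL strip `0 ≤ x₀ + x₁ ≤ L` of `ℤ²` (a row of Temperley–Lieb tiles = a staircase of lattice edges;
the walls of the medial strip run along lattice diagonals); (c) only the UPPER bound is consumed; (d) the
calibration alone does not close the crux — the line is the whole programme of the three ideator-3 cards
(qkz = (P), stream-function = (T), shift-coupling = clause (ii)), and the skeleton names each part.

THE LINE. Write `E_δ(v,f) = cornerObs (Λ δ) δ v f` for the crux's spin-1/3 corner observable (verbatim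
the crux integrand, `cornerObs`). The crux asks, on compacts `K ⊂ D`: (i) `‖E_δ‖ ≤ C δ^{1/3}`, (ii)
same-class equicontinuity at scale `δ^{1/3}`.
* (P) — THE LEVER, integrability of bond-`ℤ²` at `q = e^{2πi/3}`. In the diagonal strip
  `S_L = {0 ≤ x₀+x₁ ≤ L}` with the wall `{x₀+x₁ = 0}` wired, `L = 2m+1` odd, the `P_{1/2}`-probability
  that a site `b` next to the free face (`b₀+b₁ = L−1`) is joined to the wired wall inside the strip is
  EXACTLY Ikhlef–Ponsaing's first-site passage probability of the infinite hull,
  `P_b(L) = A_V(L) A_V(L+2) / N_8(L+1)²` (`A_V` = vertically symmetric ASMs, `N_8` = CSSCPPs) — this is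
  `stub_ipExact` (dictionary: hull through the first cut-site ⇔ the dual site next to the wired wall is
  dual-joined to the free face ⇔, by self-duality + the anti-diagonal reflection of the strip, `b` is
  joined to the wired wall; CHECKED by Monte-Carlo in this seat, 4–6·10⁴ samples each: L = 3, 5, 7 give
  0.7508(18), 0.6436(24), 0.5825(20) against 3/4, 78/121 = 0.6446, 247/425 = 0.5812); `stub_ipAsymptotic` is the Γ-function asymptotics
  `P_b(L) ≤ C L^{-1/3}` of that product (IP12 Prop. 4.9, upper half; provable now); `stub_halfArm_le_strip`
  is the lattice-symmetry glue turning it into the bound `halfArm n ≤ C' n^{-1/3}` for the DIAGONAL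
  HALF-PLANE ONE-ARM probability to depth `n` (`halfArm`, `halfArm_bound` — proved here from the three).
* (T) — `stub_twistedComparison` (HARDEST, the crux's signed `δ^{1/12}` cancellation in dimensionless
  form, card stream-function-boundary-calibration): at lattice depth `R` in any admissible discretisation of
  a Jordan Dobrushin domain, `‖cornerObs‖ ≤ C · halfArm R`. With (P) this gives the UNIFORM INNER ENVELOPE
  `‖cornerObs‖ ≤ C R^{-1/3}` (`UniformInnerEnvelope`, theorem `uniformInnerEnvelope`), from which clause
  (i) follows by compactness (`boundClause`, proved: depth `≥ dist(K,∂D)/δ → ∞` — exactly where the crux's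
  interiority of `K` is used, cf. the disprover's `edgePrecompact_false_without_compactness_of_familyExists`).
* (ii) — `stub_translationCovariance` (exact, provable now: a same-class pair of corners is a lattice
  translate, and translating the corner = translating the Dobrushin data) + `stub_shiftStability` (the
  corner observable is stable at precision `o(δ^{1/3})` under rigid shifts of the data by `o(1)`, GIVEN the
  uniform envelope: same-`ω` coupling of the two explorations, ordered-excursion merge event — the triage
  repair of the card's topological lemma —, boundary three-arm / marked-point re-rooting estimates, and a
  decoupling of the non-merge event from the inner twisted amplitude); clause (ii) is assembled from the two
  in `equicontClause` (proved).
* `EdgePrecompact_of : EdgePrecompact` — the kernel-checked composition (no `sorry` of its own).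

Disproof.lean (cdisprove v1–v4 on the item): its text is not readable from a crux-plan seat (gate evidence
store not mounted; not published under `Cruxes/EdgePrecompact/`); used through its evidence abstracts. The
stub set honours `_false_without_compactness` (all envelopes are at lattice depth `R ≥ 1`; `δ^{1/3}` appears
only after `R ≥ dist(K, Dᶜ)/δ`), the load-bearing `Ω`- and mesh-equalities (used verbatim in `boundClause` /
`equicontClause`), the envelope `‖E‖ ≤ 1` (consistent with (T) at `R = 1`), and F8 "(ii) ⇔ translation
stability" (= `stub_translationCovariance` + `stub_shiftStability`). No `Theorems/EdgePrecompact/Negative/*`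
lemma has landed; `ledger negatives` (7 CriticalPhenomena items) instantiates no stub.
## Lead's status (prover-line-stmt-CriticalPhenomena-11387-0, reshape r1, 2026-08-16)

LANDED (all `--supports stmt-CriticalPhenomena-11387`, imported above, same namespace):
`CardyComplexConeDefs` (vocabulary, p73249), `stub_ipAsymptotic` (p74392, C = 2: `ipRatio (m+1) = ipRatio m ·
(3m+5)(6m+7)(4m+3)/((3m+4)(6m+5)(4m+7))` and `ipRatio m³ (m+1)` non-increasing), `stub_halfArm_le_strip` (p75102),
`medialExploration_shiftData` (p75892, sub-goal: exploring translated data in the translated configuration gives the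
translated path), `stub_translationCovariance` (p76471), the bridge `stub_ipExact_of_IkhlefPonsaing` (p75868) from the
relocated Literature named fact `Literature.Probability.Percolation.IkhlefPonsaingFirstPassage` (p75867; IP12 Prop. 4.7;
the identity is certified EXACTLY for m ≤ 5 by rational transfer matrices, item evidence), and the reduction
`shiftStability_of : X1 → X2 → ShiftStability` (p76884).
RESHAPE r1: (a) `stub_shiftStability : UniformInnerEnvelope → ShiftStability` is EXPIRED — the unconditional envelope
bounds each observable by `C δ^{1/3}` but never a difference by `ε δ^{1/3}`; what clause (ii) needs is exactly
X1 = `stub_localInnerEnvelopeUI` (conditional inner envelope in uniform-integrability tail form: restricted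
expectations over exterior-measurable events of small probability are `≤ ε₁ (δ/ρ)^{1/3}`) and X2 =
`stub_shiftCouplingLocality` (phase-free same-`ω` coupling: the difference of the dart observables of `Λδ` and of its
lattice translate is carried by an exterior-measurable event of probability `≤ ε`), glued by the landed
`shiftStability_of`; (b) `stub_twistedComparison` is split into T1 = `stub_vertexRelation` (the half-CR vertex relation
for `cornerObs` at interior medial vertices of arbitrary admissible data, DCS Prop. 8.6 / DC 2012 Prop. 4 — the edge-flip
involution at `p = 1/2`; provable now; first identity of the stream-function mechanism) and T2 =
`stub_twistedComparison_of : T1-statement → (T)` (the open core proper: flux calibration + modulus-only inner–outer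
factorisation), with `twistedComparison := stub_twistedComparison_of stub_vertexRelation`.
OPEN registered stubs after r1: `stub_ipExact` (closed modulo the named fact via the bridge), `stub_vertexRelation` (T1),
`stub_twistedComparison_of` (T2, open core), `stub_localInnerEnvelopeUI` (X1, conditional twin of the core),
`stub_shiftCouplingLocality` (X2). `EdgePrecompact_of` still concludes the crux by name with no `sorry` of its own.
-/

namespace Summit.CriticalPhenomena.CardyFormulaZ2.Cruxes.EdgePrecompact.QkzStripBoundaryArm

open MeasureTheory Filter Set Metric
open scoped Topology BigOperators Pointwise
open Literature.Probability.LatticeModels Literature.Probability.Percolation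
open Literature.Probability.RandomPlanarGeometry (DobrushinDomain)
open Summit.CriticalPhenomena.CardyFormulaZ2.Theses.CardyComplexCone

set_option linter.unusedVariables false

noncomputable section

/-! ## Vocabulary

All objects (`cornerObs`, `diagStrip`, `diagHalfPlane`, `wallConn`, `halfArmEvent`, `halfArm`, `vsasm`,
`csscpp`, `ipRatio`, `shiftData`, `UniformInnerEnvelope`, `ShiftStability`) and the glue identities
`meshPoint_neg`, `image_add_right_eq_vadd`, `shiftData_shiftData_neg` live in the landed definitions module
`Summits/CriticalPhenomena/CardyFormulaZ2/Theorems/CardyComplexConeDefs.lean` (p73249, same namespace), which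
this skeleton and every stub helper file import. -/

/-! ## The stubs -/

/-- **(P1) `stub_ipExact` — the Ikhlef–Ponsaing calibration (THE LEVER; integrable, XL).** For odd width
`L = 2m+1` and every site `b` of the level `b₀ + b₁ = 2m` (next to the free face), the `P_{1/2}`-probability
that `b` is joined to the wired wall `{x₀+x₁ = 0}` inside the diagonal strip `{0 ≤ x₀+x₁ ≤ L}` equals
`A_V(L) A_V(L+2) / N_8(L+1)²` EXACTLY (`ipRatio m` = 1, 3/4, 78/121, 247/425, … for m = 0, 1, 2, 3).
Why plausibly true: Ikhlef–Ponsaing 2012 (arXiv:1202.5476), Prop. 4.5 (inhomogeneous qKZ solution: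
`P_b = χ_{L-1} χ_{L+1} / χ_L²`, symplectic characters; proof = symmetry Prop. 4.1 + recursion Prop. 4.3 +
degree counting + `L = 1`) and Prop. 4.7 (homogeneous limit via Di Francesco's character evaluations),
for the first-site passage probability `P_b` of the infinite hull `γ` in the width-`L` strip of the medial
lattice with wired/free (= reflecting) walls. DICTIONARY (this seat): tiles = edges of `ℤ²` between the
levels `u` and `u+1` of `x₀+x₁`, so the width-`L` medial strip is the diagonal strip `0 ≤ u ≤ L` with the
level `u = 0` wired; `γ` crosses a between-double-row cut at its first site iff the dual site at `u = 1`
of that height is dual-joined to the free face; the model is invariant under (planar duality at `p = 1/2`)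
∘ (the anti-diagonal reflection `u ↦ L − u`), which maps this event to "the primal site `b` at `u = L−1`
is joined to the wired wall", and joined-to-the-wall never needs the wall's own wiring (stop at the first
wall site), so the event is `wallConn L b` under the product measure verbatim; along the strip all `b` of
the level are translates by `(1,−1)`. Monte-Carlo check (this seat, `mc/strip_mc.py`, attached as evidence; 4–6·10⁴ samples):
L=3: 0.7508±0.0018 (3/4); L=5: 0.6436±0.0024 (78/121 = 0.6446); L=7: 0.5825±0.0020 (247/425 = 0.5812).
Why it might fail: only through the rigour of the qKZ identification (the transfer-matrix ground state =
the minimal-degree polynomial qKZ solution, Di Francesco–Zinn-Justin 2005 / de Gier–Pyatov 2007) — the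
percolation dictionary is checked. Size XL (stochastic transfer matrix on link patterns, its stationary
vector, the bilinear passage functional, the qKZ solution and the character identities; a certified
computation settles each fixed `m`). Cheapest falsifier: exact transfer-matrix evaluation at `m = 1, 2`. -/
theorem stub_ipExact : ∀ (m : ℕ) (b : Site 2), b 0 + b 1 = 2 * m →
    (bondPercolation (zdGraph 2) half).real (wallConn (2 * m + 1) b) = ipRatio m := by
  sorry

/-- **(P2) `stub_ipAsymptotic`, (P3) `stub_halfArm_le_strip`, (ii-a) `stub_translationCovariance`** — LANDED
(modules imported above; the names resolve to the landed theorems). -/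
example : (∃ C : ℝ, ∀ m : ℕ, ipRatio m ≤ C * (2 * (m : ℝ) + 1) ^ (-(1:ℝ) / 3)) ∧
    (∀ (m : ℕ) (b : Site 2), b 0 + b 1 = 2 * m → ∀ n : ℕ, 2 * m + 1 ≤ n →
      halfArm n ≤ 2 * (bondPercolation (zdGraph 2) half).real (wallConn (2 * m + 1) b)) ∧
    (∀ (E : DiscreteDobrushin) (δ : ℝ) (w v f : Site 2), IsCorner v f →
      cornerObs (shiftData E w) δ (v + w) (f + w) = cornerObs E δ v f) :=
  ⟨stub_ipAsymptotic, stub_halfArm_le_strip, stub_translationCovariance⟩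

/-- **(T1) `stub_vertexRelation` — the half-CR VERTEX RELATION for the corner observable (M–L, provable now;
reshape r1).** There is a universal chirality `χ ∈ {i, −i}` (triage T2: `χ = +i` for the tree's conventions) such
that for every ℤ²-admissible discrete Dobrushin data `E` and every medial vertex `s(x, x + eᵢ)` that is an
interior edge of `Ω_δ` (no endpoint on the discrete arcs) whose two faces are inner faces, the four corner values
at it, listed clockwise `NW, NE, SE, SW` (the table of `medialCornersAt` of the barrier file
`FKParafermionicHalfCauchyRiemann`, inlined), satisfy `E(NW) − E(SE) = χ (E(NE) − E(SW))`.
Why plausibly true: DCS 2012 Prop. 8.6 / Duminil-Copin 2012 Prop. 4 / Duminil-Copin 2013 Lemma 6.10 — the edge-flip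
involution `ω ↦ ω ⊕ e` (measure-preserving at `p = 1/2`) pairs the passages of the exploration through the medial
vertex; the winding bookkeeping at a revisited medial vertex (`±2π ∓ …`, the tree's `MedialTrailUmlaufsatz` /
`MedialCycleHopf` / `LatticeLoopWinding`) and `2 cos(π/3) = 1` (`σ = 1/3`) give the identity configuration-pair by
configuration-pair; verified to 1e−16 on exhaustive 3×3 / 4×3 boxes with 8 arc choices by triage r1-3 (T2). Same content
as the sibling route item `CardySublatticeCoherence.HalfCRVertexRelation` (stmt-CriticalPhenomena-11306) over `cornerObs`.
Why it might fail: only by a convention slip (then the other chirality holds — hence `∃ χ`). -/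
theorem stub_vertexRelation : ∃ χ : ℂ, (χ = Complex.I ∨ χ = -Complex.I) ∧ ∀ (E : DiscreteDobrushin), E.IsZdAdmissible → ∀ (x : Site 2) (i : Fin 2), (s(x, x + Pi.single i 1) ∈ (discreteDomainGraph E.Ω E.δ).edgeSet ∧ ∀ y ∈ s(x, x + Pi.single i 1), y ∉ E.zdArcA ∧ y ∉ E.zdArcB) → (∀ f : Site 2, IsCorner x f → IsCorner (x + Pi.single i 1) f → E.IsInnerFace f) → let c : Fin 4 → Site 2 × Site 2 := if i = 0 then ![(x, x), (x + Pi.single 0 1, x), (x + Pi.single 0 1, x - Pi.single 1 1), (x, x - Pi.single 1 1)] else ![(x + Pi.single 1 1, x - Pi.single 0 1), (x + Pi.single 1 1, x), (x, x), (x, x - Pi.single 0 1)]; cornerObs E E.δ (c 0).1 (c 0).2 - cornerObs E E.δ (c 2).1 (c 2).2 = χ * (cornerObs E E.δ (c 1).1 (c 1).2 - cornerObs E E.δ (c 3).1 (c 3).2) := by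
  sorry

/-- **(T2) `stub_twistedComparison_of` — THE OPEN CORE (XL; reshape r1; held by the lead).** The vertex relation
(T1) implies the exponent-free comparison (T): one constant `C` with `‖cornerObs E δ v f‖ ≤ C · halfArm R` for every
Jordan Dobrushin domain, every admissible discretisation, every corner at lattice depth `≥ R ≥ 1`.
Intended mechanism (card stream-function-boundary-calibration): (T1) makes `u(f−v)·E` the gradient of a stream function
`ψ` on `V ∪ F` (the barrier file's Green identity `sum_halfCRForm_eq_halfCRFlux`); its flux through cross-cuts is
conserved and on free arcs equals `Z_T ×` boundary passage probabilities with `|Z_T| = 1` at spin 1/3 (triage T3),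
which calibrates cut AVERAGES of `E` at depth `R` by `≲ halfArm R`; the pointwise statement needs a modulus-only
inner–outer factorisation of the twisted amplitude (route K2, "complex quasi-multiplicativity") — not in print for
`q = 1` on `ℤ²`; this is the crux's `δ^{1/12}` cancellation in dimensionless form. Why it might fail: a pointwise excess
of `|E|` over its cut average by a growing factor. -/
theorem stub_twistedComparison_of : (∃ χ : ℂ, (χ = Complex.I ∨ χ = -Complex.I) ∧ ∀ (E : DiscreteDobrushin), E.IsZdAdmissible → ∀ (x : Site 2) (i : Fin 2), (s(x, x + Pi.single i 1) ∈ (discreteDomainGraph E.Ω E.δ).edgeSet ∧ ∀ y ∈ s(x, x + Pi.single i 1), y ∉ E.zdArcA ∧ y ∉ E.zdArcB) → (∀ f : Site 2, IsCorner x f → IsCorner (x + Pi.single i 1) f → E.IsInnerFace f) → let c : Fin 4 → Site 2 × Site 2 := if i = 0 then ![(x, x), (x + Pi.single 0 1, x), (x + Pi.single 0 1, x - Pi.single 1 1), (x, x - Pi.single 1 1)] else ![(x + Pi.single 1 1, x - Pi.single 0 1), (x + Pi.single 1 1, x), (x, x), (x, x - Pi.single 0 1)]; cornerObs E E.δ (c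 0).1 (c 0).2 - cornerObs E E.δ (c 2).1 (c 2).2 = χ * (cornerObs E E.δ (c 1).1 (c 1).2 - cornerObs E E.δ (c 3).1 (c 3).2)) → ∃ C : ℝ, ∀ (D : DobrushinDomain) (E : DiscreteDobrushin), E.Ω = D.carrier → E.IsZdAdmissible → ∀ v f : Site 2, IsCorner v f → ∀ R : ℕ, 1 ≤ R → (R : ℝ) * E.δ ≤ infDist (meshPoint E.δ v) D.carrierᶜ → ‖cornerObs E E.δ v f‖ ≤ C * halfArm R := by
  sorry

/-- **(ii-b, X1) `stub_localInnerEnvelopeUI` — CONDITIONAL INNER ENVELOPE, uniform-integrability tail form (XL;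
reshape r1, replaces half of `stub_shiftStability`; conditional twin of the open core).** For every `ε₁ > 0` there is
`ε' > 0` such that for every admissible datum `E` (any bounded domain, any arcs), corner `(v,f)`, radius `ρ ≥ E.δ`
with `closedBall (δv) ρ ⊆ E.Ω` and every event `A` measurable with respect to the configuration OFF the ball
`B(δv, ρ)` with `P(A) ≤ ε'`: `‖E[F_{v,f} ; A]‖ ≤ ε₁ (E.δ/ρ)^{1/3}` (`F` = the spin-1/3 dart phase sum, `cornerObs = ∫ F`
by `cornerObs_eq_integral_dartPhaseSum`). Why plausibly true: locality + the scale-free envelope for multi-arc exterior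
patterns (DCS Conj. 8.7 normalisation at `q = 1` in local form); rare many-arm exterior patterns carry conditional
amplitudes `≫ (δ/ρ)^{1/3}` but small mass. Why it might fail: the sharp `1/3` itself. Strictly weaker than the sibling
line's affine form `Sig.stub_localInnerEnvelope`. -/
theorem stub_localInnerEnvelopeUI : ∀ ε₁ > (0:ℝ), ∃ ε' > (0:ℝ), ∀ (E : DiscreteDobrushin), E.IsZdAdmissible → ∀ v f : Site 2, IsCorner v f → ∀ ρ : ℝ, E.δ ≤ ρ → closedBall (meshPoint E.δ v) ρ ⊆ E.Ω → ∀ A : Set (BondConfig (Site 2)), MeasurableSet[MeasurableSpace.comap (fun ω : BondConfig (Site 2) => ω \ {e | medialPoint E.δ e ∈ ball (meshPoint E.δ v) ρ}) (inferInstance : MeasurableSpace (BondConfig (Site 2)))] A → (bondPercolation (zdGraph 2) half).real A ≤ ε' → ‖∫ ω in A, dartPhaseSum (medialExploration E ω) E.δ (1 / 3) (v, f) ∂(bondPercolation (zdGraph 2) half)‖ ≤ ε₁ * (E.δ / ρ) ^ ((1:ℝ) / 3) := by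
  sorry

/-- **(ii-c, X2) `stub_shiftCouplingLocality` — SHIFT-COUPLING LOCALITY (L; reshape r1, replaces the other half of
`stub_shiftStability`; phase-free).** Along a discretisation family of `D`, on a compact `K` with
`cthickening (2ρ) K ⊆ D`: for every `ε > 0` there is `η > 0` such that eventually in `δ`, for every corner `(v,f)` with
`δv ∈ K` and lattice vector `w` with `‖δw‖ < η`, the difference of the dart observables at `(v,f)` of the data `Λ δ` and
of its translate `shiftData (Λ δ) w` (SAME configuration `ω`) is carried by an event `B`, measurable with respect to the
configuration off the ball `B(δv, ρ)`, of probability `≤ ε`. Content: exterior projection of the disagreement event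
(finite cylinder algebra); pathwise lemma "same ordered excursion structure ⇒ same functional" (triage T1: bare
passage-sharing admits ±2π slips, `ShiftCouplingWindingOffsetCex.md`); `P(B) → 0` uniformly: boundary three-arm sum
over the `η`-collar of `∂D` plus marked-point re-rooting two-arm bound (RSW/arm technology for bond-ℤ², to be ported).
Why it might fail: very rough (non-porous) Jordan boundaries defeat the collar box-count. -/
theorem stub_shiftCouplingLocality : ∀ (D : DobrushinDomain) (Λ : ℝ → DiscreteDobrushin), (∀ δ, (Λ δ).Ω = D.carrier) → (∀ δ, (Λ δ).δ = δ) → (∀ᶠ δ in nhdsWithin (0:ℝ) (Set.Ioi 0), (Λ δ).IsZdAdmissible) → ∀ K : Set ℂ, IsCompact K → K ⊆ D.carrier → ∀ ρ > (0:ℝ), cthickening (2 * ρ) K ⊆ D.carrier → ∀ ε > (0:ℝ), ∃ η > (0:ℝ), ∀ᶠ δ in nhdsWithin (0:ℝ) (Set.Ioi 0), ∀ v f w : Site 2, IsCorner v f → meshPoint δ v ∈ K → ‖meshPoint δ w‖ < η → ∃ B : Set (BondConfig (Site 2)), MeasurableSet[MeasurableSpace.comap (fun ω : BondConfig (Site 2)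 => ω \ {e | medialPoint δ e ∈ ball (meshPoint δ v) ρ}) (inferInstance : MeasurableSpace (BondConfig (Site 2)))] B ∧ (bondPercolation (zdGraph 2) half).real B ≤ ε ∧ (∫ ω, dartPhaseSum (medialExploration (Λ δ) ω) δ (1 / 3) (v, f) ∂(bondPercolation (zdGraph 2) half)) - (∫ ω, dartPhaseSum (medialExploration (shiftData (Λ δ) w) ω) δ (1 / 3) (v, f) ∂(bondPercolation (zdGraph 2) half)) = (∫ ω in B, dartPhaseSum (medialExploration (Λ δ) ω) δ (1 / 3) (v, f) ∂(bondPercolation (zdGraph 2) half)) - (∫ ω in B, dartPhaseSum (medialExploration (shiftData (Λ δ) w) ω) δ (1 / 3) (v, f) ∂(bondPercolation (zdGraph 2) half)) := by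
  sorry

/-! ## Proved glue -/

/-- **(T) from (T1) + (T2)** (reshape r1). -/
theorem twistedComparison : ∃ C : ℝ, ∀ (D : DobrushinDomain) (E : DiscreteDobrushin), E.Ω = D.carrier → E.IsZdAdmissible → ∀ v f : Site 2, IsCorner v f → ∀ R : ℕ, 1 ≤ R → (R : ℝ) * E.δ ≤ infDist (meshPoint E.δ v) D.carrierᶜ → ‖cornerObs E E.δ v f‖ ≤ C * halfArm R :=
  stub_twistedComparison_of stub_vertexRelation

/-- **Shift stability from (X1) + (X2)** by the landed reduction `shiftStability_of` (p76884; reshape r1). -/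
theorem shiftStability : ShiftStability :=
  shiftStability_of stub_localInnerEnvelopeUI stub_shiftCouplingLocality

/-- **(P) assembled: the diagonal half-plane one-arm bound `halfArm n ≤ C n^{-1/3}`** from the three
(P)-stubs (exact value at the odd width `2m+1 ∈ {n−1, n}`, its asymptotics, and the symmetry glue). -/
theorem halfArm_bound : ∃ C : ℝ, 0 ≤ C ∧ ∀ n : ℕ, 1 ≤ n → halfArm n ≤ C * (n : ℝ) ^ (-(1:ℝ) / 3) := by
  obtain ⟨C, hC⟩ := stub_ipAsymptotic
  refine ⟨2 * max C 0 * (2 : ℝ) ^ ((1:ℝ) / 3), by positivity, fun n hn => ?_⟩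
  obtain ⟨m, hm⟩ : ∃ m : ℕ, m = (n - 1) / 2 := ⟨_, rfl⟩
  have hL1 : 2 * m + 1 ≤ n := by omega
  have hL2 : n ≤ 2 * (2 * m + 1) := by omega
  let b : Site 2 := ![(2 * m : ℤ), 0]
  have hbsum : b 0 + b 1 = 2 * m := by simp [b]
  have h1 : halfArm n ≤ 2 * (bondPercolation (zdGraph 2) half).real (wallConn (2 * m + 1) b) :=
    stub_halfArm_le_strip m b hbsum n hL1
  have h2 : (bondPercolation (zdGraph 2) half).real (wallConn (2 * m + 1) b) = ipRatio m :=
    stub_ipExact m b hbsum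
  have h3 : ipRatio m ≤ C * (2 * (m : ℝ) + 1) ^ (-(1:ℝ) / 3) := hC m
  have hLpos : (0 : ℝ) < 2 * (m : ℝ) + 1 := by positivity
  have hnpos : (0 : ℝ) < (n : ℝ) := by exact_mod_cast hn
  have hexp : (-(1:ℝ) / 3) ≤ 0 := by norm_num
  have hle : (n : ℝ) ≤ 2 * (2 * (m : ℝ) + 1) := by exact_mod_cast hL2
  have hcmp : (2 * (2 * (m : ℝ) + 1)) ^ (-(1:ℝ) / 3) ≤ (n : ℝ) ^ (-(1:ℝ) / 3) :=
    Real.rpow_le_rpow_of_nonpos hnpos hle hexp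
  have hsplit : (2 * (2 * (m : ℝ) + 1)) ^ (-(1:ℝ) / 3) =
      (2:ℝ) ^ (-(1:ℝ) / 3) * (2 * (m : ℝ) + 1) ^ (-(1:ℝ) / 3) :=
    Real.mul_rpow (by norm_num) hLpos.le
  have htwo : (2:ℝ) ^ ((1:ℝ) / 3) * (2:ℝ) ^ (-(1:ℝ) / 3) = 1 := by
    rw [← Real.rpow_add (by norm_num : (0:ℝ) < 2)]
    norm_num
  have hkey : (2 * (m : ℝ) + 1) ^ (-(1:ℝ) / 3) ≤ (2:ℝ) ^ ((1:ℝ) / 3) * (n : ℝ) ^ (-(1:ℝ) / 3) := by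
    calc (2 * (m : ℝ) + 1) ^ (-(1:ℝ) / 3)
        = (2:ℝ) ^ ((1:ℝ) / 3) * ((2 * (2 * (m : ℝ) + 1)) ^ (-(1:ℝ) / 3)) := by
          rw [hsplit, ← mul_assoc, htwo, one_mul]
      _ ≤ (2:ℝ) ^ ((1:ℝ) / 3) * (n : ℝ) ^ (-(1:ℝ) / 3) :=
          mul_le_mul_of_nonneg_left hcmp (by positivity)
  have hC0 : C ≤ max C 0 := le_max_left _ _
  have hmax : 0 ≤ max C 0 := le_max_right _ _
  have hr0 : 0 ≤ (2 * (m : ℝ) + 1) ^ (-(1:ℝ) / 3) := Real.rpow_nonneg hLpos.le _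
  calc halfArm n ≤ 2 * ipRatio m := by rw [← h2]; exact h1
    _ ≤ 2 * (C * (2 * (m : ℝ) + 1) ^ (-(1:ℝ) / 3)) := by linarith
    _ ≤ 2 * (max C 0 * (2 * (m : ℝ) + 1) ^ (-(1:ℝ) / 3)) :=
          mul_le_mul_of_nonneg_left (mul_le_mul_of_nonneg_right hC0 hr0) (by norm_num)
    _ ≤ 2 * (max C 0 * ((2:ℝ) ^ ((1:ℝ) / 3) * (n : ℝ) ^ (-(1:ℝ) / 3))) :=
          mul_le_mul_of_nonneg_left (mul_le_mul_of_nonneg_left hkey hmax) (by norm_num)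
    _ = 2 * max C 0 * (2:ℝ) ^ ((1:ℝ) / 3) * (n : ℝ) ^ (-(1:ℝ) / 3) := by ring

/-- **(T) + (P) ⇒ the uniform inner envelope.** -/
theorem uniformInnerEnvelope : UniformInnerEnvelope := by
  obtain ⟨CT, hT⟩ := twistedComparison
  obtain ⟨Ch, hCh0, hCh⟩ := halfArm_bound
  refine ⟨max CT 0 * Ch, fun D E hΩ hadm v f hvf R hR hdepth => ?_⟩
  have h1 : ‖cornerObs E E.δ v f‖ ≤ CT * halfArm R := hT D E hΩ hadm v f hvf R hR hdepth
  have h2 : halfArm R ≤ Ch * (R : ℝ) ^ (-(1:ℝ) / 3) := hCh R hR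
  have h0 : 0 ≤ halfArm R := measureReal_nonneg
  calc ‖cornerObs E E.δ v f‖ ≤ CT * halfArm R := h1
    _ ≤ max CT 0 * halfArm R := mul_le_mul_of_nonneg_right (le_max_left _ _) h0
    _ ≤ max CT 0 * (Ch * (R : ℝ) ^ (-(1:ℝ) / 3)) := mul_le_mul_of_nonneg_left h2 (le_max_right _ _)
    _ = max CT 0 * Ch * (R : ℝ) ^ (-(1:ℝ) / 3) := by ring

/-- **Clause (i) of the crux from the uniform inner envelope, by compactness** (this is where the
interiority of `K` enters: lattice depth `≥ dist(K, Dᶜ)/δ → ∞`). -/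
theorem boundClause (hU : UniformInnerEnvelope) (D : DobrushinDomain) (Λ : ℝ → DiscreteDobrushin)
    (hΩ : ∀ δ, (Λ δ).Ω = D.carrier) (hδ : ∀ δ, (Λ δ).δ = δ)
    (hadm : ∀ᶠ δ in 𝓝[>] (0:ℝ), (Λ δ).IsZdAdmissible) (K : Set ℂ) (hK : IsCompact K)
    (hKD : K ⊆ D.carrier) :
    ∃ C : ℝ, ∀ᶠ δ in 𝓝[>] (0:ℝ), ∀ v f : Site 2, IsCorner v f → meshPoint δ v ∈ K →
      ‖cornerObs (Λ δ) δ v f‖ ≤ C * δ ^ ((1:ℝ) / 3) := by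
  obtain ⟨C, hC⟩ := hU
  obtain ⟨ρ, hρ, hρD⟩ := hK.exists_thickening_subset_open D.isOpen hKD
  refine ⟨max C 0 * (2 / ρ) ^ ((1:ℝ) / 3), ?_⟩
  have hsmall : ∀ᶠ δ in 𝓝[>] (0:ℝ), δ ∈ Ioo (0:ℝ) (ρ / 2) := Ioo_mem_nhdsGT (by positivity)
  filter_upwards [hadm, hsmall] with δ hδadm hδI
  obtain ⟨hδ0, hδρ⟩ := hδI
  intro v f hvf hvK
  -- the complement of the domain is nonempty and at distance ≥ ρ from the corner
  have hDc : D.carrierᶜ.Nonempty := by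
    obtain ⟨y, hy⟩ := (Set.ne_univ_iff_exists_notMem _).1 D.toJordanDomain.carrier_ne_univ
    exact ⟨y, hy⟩
  have hdist : ρ ≤ infDist (meshPoint δ v) D.carrierᶜ := by
    rw [le_infDist hDc]
    intro y hy
    by_contra hlt
    have hlt' : dist (meshPoint δ v) y < ρ := lt_of_not_ge hlt
    have hyb : y ∈ ball (meshPoint δ v) ρ := by
      rw [mem_ball, dist_comm]; exact hlt'
    exact hy (hρD (ball_subset_thickening hvK ρ hyb))
  -- the lattice depth R = ⌊ρ/δ⌋
  obtain ⟨R, hR⟩ : ∃ R : ℕ, R = ⌊ρ / δ⌋₊ := ⟨_, rfl⟩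
  have hρδ : 2 ≤ ρ / δ := by
    rw [le_div_iff₀ hδ0]; linarith
  have hR1 : 1 ≤ R := by
    rw [hR]
    exact Nat.floor_pos.2 (by linarith)
  have hRle : (R : ℝ) * δ ≤ ρ := by
    have : (R : ℝ) ≤ ρ / δ := by rw [hR]; exact Nat.floor_le (by positivity)
    rwa [le_div_iff₀ hδ0] at this
  have hRge : ρ / (2 * δ) ≤ (R : ℝ) := by
    have hlt : ρ / δ < (R : ℝ) + 1 := by rw [hR]; exact Nat.lt_floor_add_one _
    have hhalf : ρ / δ = 2 * (ρ / (2 * δ)) := by field_simp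
    linarith
  have hx : 0 < ρ / (2 * δ) := by positivity
  -- the envelope at depth R
  have hE : (Λ δ).δ = δ := hδ δ
  have h := hC D (Λ δ) (hΩ δ) hδadm v f hvf R hR1 (by rw [hE]; exact le_trans hRle hdist)
  rw [hE] at h
  -- R^{-1/3} ≤ (ρ/(2δ))^{-1/3} = (2/ρ)^{1/3} δ^{1/3}
  have hexp : (-(1:ℝ) / 3) ≤ 0 := by norm_num
  have hmono : (R : ℝ) ^ (-(1:ℝ) / 3) ≤ (ρ / (2 * δ)) ^ (-(1:ℝ) / 3) :=
    Real.rpow_le_rpow_of_nonpos hx hRge hexp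
  have hpow : (ρ / (2 * δ)) ^ (-(1:ℝ) / 3) = (2 / ρ) ^ ((1:ℝ) / 3) * δ ^ ((1:ℝ) / 3) := by
    calc (ρ / (2 * δ)) ^ (-(1:ℝ) / 3) = ((ρ / (2 * δ)) ^ ((1:ℝ) / 3))⁻¹ := by
            rw [show (-(1:ℝ) / 3) = -((1:ℝ) / 3) by ring, Real.rpow_neg hx.le]
      _ = ((ρ / (2 * δ))⁻¹) ^ ((1:ℝ) / 3) := (Real.inv_rpow hx.le _).symm
      _ = ((2 / ρ) * δ) ^ ((1:ℝ) / 3) := by rw [inv_div]; ring_nf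
      _ = (2 / ρ) ^ ((1:ℝ) / 3) * δ ^ ((1:ℝ) / 3) := Real.mul_rpow (by positivity) hδ0.le
  have hr0 : 0 ≤ (R : ℝ) ^ (-(1:ℝ) / 3) := Real.rpow_nonneg (by positivity) _
  calc ‖cornerObs (Λ δ) δ v f‖ ≤ C * (R : ℝ) ^ (-(1:ℝ) / 3) := h
    _ ≤ max C 0 * (R : ℝ) ^ (-(1:ℝ) / 3) := mul_le_mul_of_nonneg_right (le_max_left _ _) hr0
    _ ≤ max C 0 * (ρ / (2 * δ)) ^ (-(1:ℝ) / 3) := mul_le_mul_of_nonneg_left hmono (le_max_right _ _)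
    _ = max C 0 * (2 / ρ) ^ ((1:ℝ) / 3) * δ ^ ((1:ℝ) / 3) := by rw [hpow]; ring

/-- **Clause (ii) of the crux from translation covariance + shift stability.** -/
theorem equicontClause (hS : ShiftStability)
    (hcov : ∀ (E : DiscreteDobrushin) (δ : ℝ) (w v f : Site 2), IsCorner v f →
      cornerObs (shiftData E w) δ (v + w) (f + w) = cornerObs E δ v f)
    (D : DobrushinDomain) (Λ : ℝ → DiscreteDobrushin)
    (hΩ : ∀ δ, (Λ δ).Ω = D.carrier) (hδ : ∀ δ, (Λ δ).δ = δ)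
    (hadm : ∀ᶠ δ in 𝓝[>] (0:ℝ), (Λ δ).IsZdAdmissible) (K : Set ℂ) (hK : IsCompact K)
    (hKD : K ⊆ D.carrier) :
    ∀ ε > (0:ℝ), ∃ η > (0:ℝ), ∀ᶠ δ in 𝓝[>] (0:ℝ), ∀ v f v' f' : Site 2,
      IsCorner v f → IsCorner v' f' → f - v = f' - v' → meshPoint δ v ∈ K → meshPoint δ v' ∈ K →
      dist (meshPoint δ v) (meshPoint δ v') < η →
      ‖cornerObs (Λ δ) δ v f - cornerObs (Λ δ) δ v' f'‖ ≤ ε * δ ^ ((1:ℝ) / 3) := by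
  intro ε hε
  obtain ⟨η, hη, hev⟩ := hS D Λ hΩ hδ hadm K hK hKD ε hε
  refine ⟨η, hη, ?_⟩
  filter_upwards [hev] with δ hδev
  intro v f v' f' hvf hv'f' hclass hvK hv'K hdist
  have e1 : v + (v' - v) = v' := by abel
  have e2 : f + (v' - v) = f' := by
    calc f + (v' - v) = (f - v) + v' := by abel
      _ = (f' - v') + v' := by rw [hclass]
      _ = f' := sub_add_cancel f' v'
  have key : cornerObs (Λ δ) δ v' f' = cornerObs (shiftData (Λ δ) (-(v' - v))) δ v f := by
    have h := hcov (shiftData (Λ δ) (-(v' - v))) δ (v' - v) v f hvf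
    rw [shiftData_shiftData_neg, e1, e2] at h
    exact h
  rw [key]
  exact hδev v f (v' - v) hvf hvK (by rw [e1]; exact hv'K) (by rw [e1]; exact hdist)

/-! ## The composition (kernel-checked, no `sorry` of its own) -/

/-- **`EdgePrecompact` from the six stubs.** Clause (i): (T) `stub_twistedComparison` + (P)
(`stub_ipExact`, `stub_ipAsymptotic`, `stub_halfArm_le_strip`) give `UniformInnerEnvelope`; compactness
of `K` inside the open `D` gives lattice depth `≥ ρ/δ`, whence `C_K δ^{1/3}`. Clause (ii):
`stub_translationCovariance` rewrites the same-class partner `(v',f') = (v+w, f+w)` as the corner `(v,f)`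
of the data shifted by `−w`, and `shiftStability` (X1 + X2 via `shiftStability_of`) bounds the difference. The
crux's `E δ v f` is `cornerObs (Λ δ) δ v f` by `rfl`. -/
theorem EdgePrecompact_of : EdgePrecompact := by
  intro D Λ hΩ hδ hadm E K hK hKD
  exact ⟨boundClause uniformInnerEnvelope D Λ hΩ hδ hadm K hK hKD,
    equicontClause shiftStability stub_translationCovariance
      D Λ hΩ hδ hadm K hK hKD⟩

end

end Summit.CriticalPhenomena.CardyFormulaZ2.Cruxes.EdgePrecompact.QkzStripBoundaryArm
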